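import Mathlib.GroupTheory.PGroup
import Mathlib.GroupTheory.GroupAction.ConjAct
import Mathlib.GroupTheory.QuotientGroup.Basic
import Summits.MatrixMultiplication.OmegaCensus.BoxBadKleinRotation
import Summits.MatrixMultiplication.OmegaCensus.BoxUsefulSections

/-!
# ω-census, family (b3): conjecture C9 (b) — the Schmidt-atom configuration in relation form, and where it is forced

HONEST FRAMING (pub-omega census; verbatim): lottery ticket; floor = certified bounds/negative ranges.
Census BOOKKEEPING (conjecture C9 of the cell, STRUCTURE.md §2, `BoxRatioSectionLaw`; pub-omega kernel-l4 gen 17, task K-5″ —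
the structure side of C9 (b) for ALL primes).  Nothing here is progress on `ω`.

THE CONFIGURATION.  For elements `a, y` of a group and naturals `p, q`, `AtomConfig p q a y` says: `a ≠ 1`, `a ^ p = 1`, the
conjugates `yⁱ a y⁻ⁱ` commute pairwise, `y^q` centralises `a`, and the *conjugation trace*
`conjTrace y a q = a · (y a y⁻¹) · (y² a y⁻²) ⋯ (y^{q-1} a y^{-(q-1)})` is `1`.  For primes `p ≠ q` this is exactly the
relation-level shadow of the Schmidt atom `A(p,q) = 𝔽_{p^k} ⋊ μ_q`: `W = ⟨yⁱ a y⁻ⁱ⟩` is an elementary abelian `p`-group on which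
`⟨y⟩/⟨y^q⟩ ≅ C_q` acts without fixed points (trace `0` ⇔ no fixed vector), so `⟨a, y⟩/⟨y^q⟩ = W ⋊ C_q` is a Frobenius group
containing `A(p,q)`.  Conversely every faithful coprime action produces the configuration (`exists_atomConfig`, below).

RESULTS.
* `AtomConfig.map` — transport along injective homomorphisms.
* `AtomConfig.not_boxUseful_two_three` — the pair `(2,3)` (the atom `A₄`) is discharged in the tree: the configuration is the
  rotation form of `KleinRot.not_boxUseful_of_rot3`.
* TRACE LEMMA `exists_atomConfig` — if `V` is an abelian subgroup of exponent `p` normalised by `y`, `y^q` centralises `V` but `y`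
  does not, then some `a ∈ V` carries `AtomConfig p q a y` (the trace `v ↦ ∏_{i<q} yⁱ v y⁻ⁱ` is an endomorphism of `V` with
  `y`-fixed image, hence not injective).
* `p`-QUOTIENT LEMMA `exists_prime_pow_centralizes` — if `V ⊴ G` is a non-trivial `p`-group meeting `Z(G)` trivially, then some
  `y ∉ C_G(V)` has `y^q ∈ C_G(V)` for a prime `q ≠ p` (otherwise `G/C_G(V)` is a `p`-group acting on `V` with a non-trivial fixed
  point, which would be central).
* `exists_atomConfig_of_normal` — both combined: a non-trivial normal elementary abelian `p`-subgroup avoiding the centre forces an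
  `AtomConfig p q a y` with `q` prime, `q ≠ p`, inside `G` itself.
* `AtomBad p q` — the ATOM HYPOTHESIS for the pair `(p,q)`: every finite group with an `AtomConfig p q` is box-useless
  (`atomBad_two_three` discharges `(2,3)`; the other pairs are the cell's atom lane, stpp-1).
These are the two group-theoretic inputs of `BoxRatioSectionLawAtoms` (C9 (b) for every finite solvable group modulo the atoms).
-/

namespace Summit.MatrixMultiplication.OmegaCensus

open MulAction

variable {G : Type*} [Group G]

/-- The *conjugation trace* `conjTrace y a n = a · (y a y⁻¹) · (y² a y⁻²) ⋯ (y^{n-1} a y^{-(n-1)})`, defined by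
`conjTrace y a 0 = 1`, `conjTrace y a (n+1) = a · y (conjTrace y a n) y⁻¹`. [folklore] -/
def conjTrace (y a : G) : ℕ → G
  | 0 => 1
  | n + 1 => a * (y * conjTrace y a n * y⁻¹)

/-- `conjTrace y a 0 = 1`. [folklore] -/
@[simp] theorem conjTrace_zero (y a : G) : conjTrace y a 0 = 1 := rfl

/-- `conjTrace y a (n+1) = a · y (conjTrace y a n) y⁻¹`. [folklore] -/
theorem conjTrace_succ (y a : G) (n : ℕ) : conjTrace y a (n + 1) = a * (y * conjTrace y a n * y⁻¹) := rfl

/-- `conjTrace y 1 n = 1`. [folklore] -/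
@[simp] theorem conjTrace_one_right (y : G) (n : ℕ) : conjTrace y 1 n = 1 := by
  induction n with
  | zero => rfl
  | succ n ih => rw [conjTrace_succ, ih]; group

/-- Conjugating a trace by `y` shifts it: `y (conjTrace y a n) y⁻¹ = conjTrace y (y a y⁻¹) n`. [folklore] -/
theorem conj_conjTrace (y a : G) (n : ℕ) : y * conjTrace y a n * y⁻¹ = conjTrace y (y * a * y⁻¹) n := by
  induction n with
  | zero => simp
  | succ n ih =>
    rw [conjTrace_succ, conjTrace_succ, ← ih]
    group

/-- Appending the last factor: `conjTrace y a (n+1) = conjTrace y a n · (yⁿ a y⁻ⁿ)`. [folklore] -/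
theorem conjTrace_succ' (y a : G) (n : ℕ) : conjTrace y a (n + 1) = conjTrace y a n * (y ^ n * a * (y ^ n)⁻¹) := by
  induction n with
  | zero => simp [conjTrace_succ]
  | succ n ih =>
    have e : y * (y ^ n * a * (y ^ n)⁻¹) * y⁻¹ = y ^ (n + 1) * a * (y ^ (n + 1))⁻¹ := by
      rw [pow_succ', mul_inv_rev]; simp only [mul_assoc]
    calc conjTrace y a (n + 1 + 1) = a * (y * conjTrace y a (n + 1) * y⁻¹) := rfl
      _ = a * (y * (conjTrace y a n * (y ^ n * a * (y ^ n)⁻¹)) * y⁻¹) := by rw [ih]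
      _ = (a * (y * conjTrace y a n * y⁻¹)) * (y * (y ^ n * a * (y ^ n)⁻¹) * y⁻¹) := by group
      _ = conjTrace y a (n + 1) * (y ^ (n + 1) * a * (y ^ (n + 1))⁻¹) := by rw [e]; rfl

/-- A homomorphism maps traces to traces. [folklore] -/
theorem map_conjTrace {K : Type*} [Group K] (f : G →* K) (y a : G) (n : ℕ) :
    f (conjTrace y a n) = conjTrace (f y) (f a) n := by
  induction n with
  | zero => simp
  | succ n ih => simp [conjTrace_succ, ih]

/-- **The Schmidt-atom configuration in relation form.** `a ≠ 1`, `a ^ p = 1`, the `y`-conjugates of `a` commute pairwise,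
`y ^ q` centralises `a`, and the conjugation trace of length `q` vanishes.  For primes `p ≠ q`: `⟨a, y⟩ / ⟨y^q⟩` is a Frobenius
group `𝔽_p^k ⋊ C_q` containing the atom `A(p,q)`. [folklore] -/
def AtomConfig (p q : ℕ) (a y : G) : Prop :=
  a ≠ 1 ∧ a ^ p = 1 ∧ (∀ i j : ℕ, Commute (y ^ i * a * (y ^ i)⁻¹) (y ^ j * a * (y ^ j)⁻¹)) ∧
    y ^ q * a * (y ^ q)⁻¹ = a ∧ conjTrace y a q = 1

namespace AtomConfig

variable {p q : ℕ} {a y : G}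

/-- Transport of the configuration along an injective homomorphism. [folklore] -/
theorem map {K : Type*} [Group K] (h : AtomConfig p q a y) (f : G →* K) (hf : Function.Injective f) :
    AtomConfig p q (f a) (f y) := by
  obtain ⟨h1, hp, hc, hq, ht⟩ := h
  refine ⟨fun e => h1 (hf (by rw [e, map_one])), by rw [← map_pow, hp, map_one], fun i j => ?_, ?_, ?_⟩
  · have := (hc i j).map f
    simpa [map_mul, map_pow, map_inv] using this
  · have := congrArg f hq
    simpa [map_mul, map_pow, map_inv] using this
  · rw [← map_conjTrace, ht, map_one]

/-- In the configuration `y` does not centralise `a` when `p, q` are distinct primes (the trace of a fixed `a` would be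
`a^q ≠ 1`). [folklore] -/
theorem conj_ne (h : AtomConfig p q a y) (hp : p.Prime) (hq : q.Prime) (hpq : p ≠ q) : y * a * y⁻¹ ≠ a := by
  obtain ⟨h1, hap, -, -, ht⟩ := h
  intro e
  have key : ∀ n, conjTrace y a n = a ^ n := by
    intro n
    induction n with
    | zero => simp
    | succ n ih =>
      rw [conjTrace_succ, ih]
      have hc : y * a ^ n * y⁻¹ = (y * a * y⁻¹) ^ n := by rw [← MulAut.conj_apply, map_pow, MulAut.conj_apply]
      rw [hc, e, pow_succ']
  rw [key] at ht
  -- `a ^ q = 1` and `a ^ p = 1` with `p, q` distinct primes force `a = 1`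
  have hg : a ^ Nat.gcd p q = 1 := pow_gcd_eq_one.2 ⟨hap, ht⟩
  rw [(Nat.coprime_primes hp hq).2 hpq, pow_one] at hg
  exact h1 hg

/-- **The pair `(2,3)` is discharged** (the atom `A(2,3) = A₄`): an `AtomConfig 2 3 a y` is the rotation form of a Klein
four-group `{1, a, y a y⁻¹, y² a y⁻²}` permuted cyclically by `y`, so `G` is not box-useful by
`KleinRot.not_boxUseful_of_rot3`. [folklore] -/
theorem not_boxUseful_two_three [Fintype G] [DecidableEq G] (h : AtomConfig 2 3 a y) : ¬ BoxUseful G := by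
  have hne : y * a * y⁻¹ ≠ a := h.conj_ne Nat.prime_two Nat.prime_three (by decide)
  obtain ⟨h1, ha2, hc, h3, ht⟩ := h
  have ha2' : a * a = 1 := by rw [← pow_two]; exact ha2
  have c01 := hc 0 1
  have c02 := hc 0 2
  have c12 := hc 1 2
  simp only [pow_zero, one_mul, inv_one, mul_one, pow_one] at c01 c02 c12
  have e2 : y ^ 2 * a * (y ^ 2)⁻¹ = y * y * a * y⁻¹ * y⁻¹ := by
    rw [pow_two, mul_inv_rev]; simp only [mul_assoc]
  rw [e2] at c02 c12
  have e3 : y ^ 3 * a * (y ^ 3)⁻¹ = y * y * y * a * y⁻¹ * y⁻¹ * y⁻¹ := by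
    rw [show y ^ 3 = y * y * y by rw [pow_succ, pow_two]]; simp only [mul_inv_rev, mul_assoc]
  rw [e3] at h3
  exact KleinRot.not_boxUseful_of_rot3 ha2' c01.eq c02.eq c12.eq h3 hne

end AtomConfig

/-! ### The trace lemma -/

section Trace

variable {V : Subgroup G} {y : G}

/-- Powers of an element normalising `V` normalise `V`. [folklore] -/
theorem pow_conj_mem (hy : ∀ v ∈ V, y * v * y⁻¹ ∈ V) (i : ℕ) {v : G} (hv : v ∈ V) : y ^ i * v * (y ^ i)⁻¹ ∈ V := by
  induction i with
  | zero => simpa using hv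
  | succ i ih =>
    have : y ^ (i + 1) * v * (y ^ (i + 1))⁻¹ = y * (y ^ i * v * (y ^ i)⁻¹) * y⁻¹ := by rw [pow_succ']; group
    rw [this]
    exact hy _ ih

/-- Traces of elements of `V` stay in `V` (when `y` normalises `V`). [folklore] -/
theorem conjTrace_mem (hy : ∀ v ∈ V, y * v * y⁻¹ ∈ V) (n : ℕ) {v : G} (hv : v ∈ V) : conjTrace y v n ∈ V := by
  induction n with
  | zero => exact V.one_mem
  | succ n ih => exact V.mul_mem hv (hy _ ih)

/-- On an abelian subgroup normalised by `y` the trace is multiplicative. [folklore] -/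
theorem conjTrace_mul (hVab : ∀ v ∈ V, ∀ w ∈ V, v * w = w * v) (hy : ∀ v ∈ V, y * v * y⁻¹ ∈ V) (n : ℕ)
    {v w : G} (hv : v ∈ V) (hw : w ∈ V) : conjTrace y (v * w) n = conjTrace y v n * conjTrace y w n := by
  induction n with
  | zero => simp
  | succ n ih =>
    rw [conjTrace_succ, conjTrace_succ, conjTrace_succ, ih]
    have h1 : y * (conjTrace y v n * conjTrace y w n) * y⁻¹ =
        (y * conjTrace y v n * y⁻¹) * (y * conjTrace y w n * y⁻¹) := by group
    rw [h1]
    have hc : w * (y * conjTrace y v n * y⁻¹) = (y * conjTrace y v n * y⁻¹) * w :=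
      hVab w hw _ (hy _ (conjTrace_mem hy n hv))
    calc v * w * (y * conjTrace y v n * y⁻¹ * (y * conjTrace y w n * y⁻¹))
        = v * (w * (y * conjTrace y v n * y⁻¹)) * (y * conjTrace y w n * y⁻¹) := by group
      _ = v * ((y * conjTrace y v n * y⁻¹) * w) * (y * conjTrace y w n * y⁻¹) := by rw [hc]
      _ = v * (y * conjTrace y v n * y⁻¹) * (w * (y * conjTrace y w n * y⁻¹)) := by group

/-- … hence it inverts inverses. [folklore] -/
theorem conjTrace_inv (hVab : ∀ v ∈ V, ∀ w ∈ V, v * w = w * v) (hy : ∀ v ∈ V, y * v * y⁻¹ ∈ V) (n : ℕ)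
    {v : G} (hv : v ∈ V) : conjTrace y v⁻¹ n = (conjTrace y v n)⁻¹ := by
  have h := conjTrace_mul hVab hy n (V.inv_mem hv) hv
  rw [inv_mul_cancel, conjTrace_one_right] at h
  exact eq_inv_of_mul_eq_one_left h.symm

/-- If `y^q` centralises `V` (abelian, normalised by `y`) then every trace of length `q` is fixed by `y`. [folklore] -/
theorem conj_conjTrace_eq (hVab : ∀ v ∈ V, ∀ w ∈ V, v * w = w * v) (hy : ∀ v ∈ V, y * v * y⁻¹ ∈ V) {q : ℕ}
    (hyq : ∀ v ∈ V, y ^ q * v * (y ^ q)⁻¹ = v) {v : G} (hv : v ∈ V) :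
    y * conjTrace y v q * y⁻¹ = conjTrace y v q := by
  -- `v · y T(v) y⁻¹ = T_{q+1}(v) = T(v) · y^q v y^{-q} = T(v) · v`, and `v` commutes with `T(v)`
  have h1 : v * (y * conjTrace y v q * y⁻¹) = conjTrace y v q * v := by
    rw [← conjTrace_succ, conjTrace_succ', hyq v hv]
  have hc : v * conjTrace y v q = conjTrace y v q * v := hVab v hv _ (conjTrace_mem hy q hv)
  rw [← hc] at h1
  exact mul_left_cancel h1

/-- **Trace lemma.** Let `V` be an abelian subgroup of exponent `p`, normalised by `y`, with `y^q` centralising `V` but `y`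
not.  Then some `a ∈ V` carries the configuration `AtomConfig p q a y`.  (The trace is an endomorphism of the finite group `V`
whose image is fixed by `y`; were it injective it would be onto and `y` would centralise `V`; an element of its kernel is the
required `a`.) [folklore] -/
theorem exists_atomConfig [Finite G] {p q : ℕ} (hVab : ∀ v ∈ V, ∀ w ∈ V, v * w = w * v) (hVp : ∀ v ∈ V, v ^ p = 1)
    (hy : ∀ v ∈ V, y * v * y⁻¹ ∈ V) (hyV : ∃ v ∈ V, y * v * y⁻¹ ≠ v) (hyq : ∀ v ∈ V, y ^ q * v * (y ^ q)⁻¹ = v) :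
    ∃ a ∈ V, AtomConfig p q a y := by
  classical
  let T : V → V := fun v => ⟨conjTrace y v q, conjTrace_mem hy q v.2⟩
  have hT : ∀ v : V, ((T v : V) : G) = conjTrace y v q := fun v => rfl
  have hTinj : ¬ Function.Injective T := by
    intro hinj
    have hsurj : Function.Surjective T := Finite.surjective_of_injective hinj
    obtain ⟨v, hv, hne⟩ := hyV
    obtain ⟨w, hw⟩ := hsurj ⟨v, hv⟩
    have hwv : conjTrace y w q = v := by rw [← hT, hw]
    exact hne (by rw [← hwv]; exact conj_conjTrace_eq hVab hy hyq w.2)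
  unfold Function.Injective at hTinj
  push Not at hTinj
  obtain ⟨v, w, hvw, hne⟩ := hTinj
  have hvw' : conjTrace y v q = conjTrace y w q := by rw [← hT, ← hT, hvw]
  have hmem : (v : G) * (w : G)⁻¹ ∈ V := V.mul_mem v.2 (V.inv_mem w.2)
  refine ⟨(v : G) * (w : G)⁻¹, hmem, ?_, hVp _ hmem, fun i j => ?_, hyq _ hmem, ?_⟩
  · intro e
    exact hne (Subtype.ext (mul_inv_eq_one.1 e))
  · exact hVab _ (pow_conj_mem hy i hmem) _ (pow_conj_mem hy j hmem)
  · rw [conjTrace_mul hVab hy q v.2 (V.inv_mem w.2), conjTrace_inv hVab hy q w.2, hvw', mul_inv_cancel]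

end Trace

/-! ### The `p`-quotient lemma -/

section PQuotient

variable [Finite G] {p : ℕ} [Fact p.Prime]

/-- **`p`-quotient lemma.** Let `V ⊴ G` be a non-trivial `p`-subgroup with `V ∩ Z(G) = 1`.  Then there are `y ∈ G` and a prime
`q ≠ p` such that `y` does not centralise `V` but `y^q` does.  (Otherwise every element of `G/C_G(V)` has `p`-power order, so
this `p`-group acting faithfully on the `p`-group `V` fixes a non-trivial element, which is then central.) [folklore] -/
theorem exists_prime_pow_centralizes (V : Subgroup G) [hVn : V.Normal] (hV : IsPGroup p V) (hV1 : V ≠ ⊥)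
    (hVZ : ∀ v ∈ V, (∀ g : G, g * v = v * g) → v = 1) :
    ∃ (y : G) (q : ℕ), q.Prime ∧ q ≠ p ∧ (∃ v ∈ V, y * v * y⁻¹ ≠ v) ∧ ∀ v ∈ V, y ^ q * v * (y ^ q)⁻¹ = v := by
  classical
  by_contra hno
  push Not at hno
  -- reshaped: `y^q` centralising `V` for a prime `q ≠ p` forces `y` to centralise `V`
  have hno' : ∀ (y : G) (q : ℕ), q.Prime → q ≠ p → (∀ v ∈ V, y ^ q * v * (y ^ q)⁻¹ = v) →
      ∀ v ∈ V, y * v * y⁻¹ = v := by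
    intro y q hq hqp hyq
    by_contra hcon
    push Not at hcon
    obtain ⟨v, hv, hne⟩ := hno y q hq hqp hcon
    exact hne (hyq v hv)
  haveI hCn : (Subgroup.centralizer (V : Set G)).Normal := inferInstance
  set C := Subgroup.centralizer (V : Set G) with hCdef
  have hC : ∀ g : G, g ∈ C ↔ ∀ v ∈ V, g * v * g⁻¹ = v := by
    intro g
    rw [hCdef, Subgroup.mem_centralizer_iff]
    refine ⟨fun h v hv => ?_, fun h v hv => ?_⟩
    · rw [mul_inv_eq_iff_eq_mul, h v hv]
    · exact (mul_inv_eq_iff_eq_mul.1 (h v hv)).symm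
  -- `G / C` is a `p`-group
  have hQ : IsPGroup p (G ⧸ C) := by
    have hcard : Nat.card (G ⧸ C) ≠ 0 := Nat.card_pos.ne'
    have hprime : ∀ {d : ℕ}, d.Prime → d ∣ Nat.card (G ⧸ C) → d = p := by
      intro d hd hdvd
      by_contra hdp
      haveI : Fact d.Prime := ⟨hd⟩
      obtain ⟨x, hx⟩ := exists_prime_orderOf_dvd_card' d hdvd
      obtain ⟨y, rfl⟩ := QuotientGroup.mk_surjective x
      have hyq : y ^ d ∈ C := by
        rw [← QuotientGroup.eq_one_iff, QuotientGroup.mk_pow, ← hx, pow_orderOf_eq_one]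
      have hyC : y ∈ C := (hC y).2 (hno' y d hd hdp ((hC _).1 hyq))
      have h1 : (y : G ⧸ C) = 1 := (QuotientGroup.eq_one_iff y).2 hyC
      rw [h1, orderOf_one] at hx
      exact hd.one_lt.ne hx
    exact IsPGroup.of_card (Nat.eq_prime_pow_of_unique_prime_dvd hcard hprime)
  -- the action of `G / C` on `V`
  let φ : G →* MulAut V := MulAut.conjNormal
  have hφ : C ≤ φ.ker := by
    intro g hg
    rw [MonoidHom.mem_ker]
    ext v
    rw [MulAut.conjNormal_apply, MulAut.one_apply]
    exact (hC g).1 hg v v.2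
  let ψ : G ⧸ C →* MulAut V := QuotientGroup.lift C φ hφ
  letI : MulAction (G ⧸ C) V := MulAction.compHom V ψ
  have hsmul : ∀ (g : G) (v : V), ((((g : G ⧸ C) • v) : V) : G) = g * v * g⁻¹ := by
    intro g v
    change ((ψ (g : G ⧸ C) v : V) : G) = _
    rw [QuotientGroup.lift_mk]
    exact MulAut.conjNormal_apply g v
  have hmod := hQ.card_modEq_card_fixedPoints V
  -- `p ∣ |V|`, hence `p ∣ |fixed points|`
  haveI : Nontrivial V := (V.nontrivial_iff_ne_bot).2 hV1
  obtain ⟨n, hn, hVc⟩ := hV.nontrivial_iff_card.1 inferInstance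
  have hpV : p ∣ Nat.card V := by rw [hVc]; exact dvd_pow_self p hn.ne'
  have hpF : p ∣ Nat.card (fixedPoints (G ⧸ C) V) :=
    (Nat.modEq_zero_iff_dvd.1 ((Nat.modEq_zero_iff_dvd.2 hpV).symm.trans hmod).symm)
  -- so there is a non-trivial fixed point
  have h1F : (1 : V) ∈ fixedPoints (G ⧸ C) V := by
    rw [mem_fixedPoints]
    intro x
    obtain ⟨g, rfl⟩ := QuotientGroup.mk_surjective x
    exact Subtype.ext (by rw [hsmul]; simp)
  haveI : Nonempty (fixedPoints (G ⧸ C) V) := ⟨⟨1, h1F⟩⟩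
  have hcardF : 1 < Nat.card (fixedPoints (G ⧸ C) V) :=
    lt_of_lt_of_le (Fact.out : p.Prime).one_lt (Nat.le_of_dvd Nat.card_pos hpF)
  haveI : Nontrivial (fixedPoints (G ⧸ C) V) := Finite.one_lt_card_iff_nontrivial.1 hcardF
  obtain ⟨⟨w, hwF⟩, hw1⟩ := exists_ne (⟨1, h1F⟩ : fixedPoints (G ⧸ C) V)
  have hw1' : (w : G) ≠ 1 := by
    intro e; apply hw1; exact Subtype.ext (Subtype.ext (by simpa using e))
  rw [mem_fixedPoints] at hwF
  refine hw1' (hVZ w w.2 fun g => ?_)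
  have := congrArg (fun u : V => (u : G)) (hwF (g : G ⧸ C))
  simp only [hsmul] at this
  exact mul_inv_eq_iff_eq_mul.1 this

end PQuotient

/-- **Both lemmas combined.** A non-trivial normal abelian subgroup of prime exponent `p` meeting the centre trivially forces,
inside `G` itself, a configuration `AtomConfig p q a y` with `q` prime, `q ≠ p`, `a ∈ V`. [folklore] -/
theorem exists_atomConfig_of_normal [Finite G] {p : ℕ} (hp : p.Prime) (V : Subgroup G) [V.Normal]
    (hVab : ∀ v ∈ V, ∀ w ∈ V, v * w = w * v) (hVp : ∀ v ∈ V, v ^ p = 1) (hV1 : V ≠ ⊥)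
    (hVZ : ∀ v ∈ V, (∀ g : G, g * v = v * g) → v = 1) :
    ∃ (q : ℕ) (a y : G), q.Prime ∧ q ≠ p ∧ a ∈ V ∧ AtomConfig p q a y := by
  haveI : Fact p.Prime := ⟨hp⟩
  have hV : IsPGroup p V := fun v => ⟨1, Subtype.ext (by simpa using hVp v v.2)⟩
  obtain ⟨y, q, hq, hqp, hyV, hyq⟩ := exists_prime_pow_centralizes V hV hV1 hVZ
  have hy : ∀ v ∈ V, y * v * y⁻¹ ∈ V := fun v hv => ‹V.Normal›.conj_mem v hv y
  obtain ⟨a, haV, ha⟩ := exists_atomConfig hVab hVp hy hyV hyq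
  exact ⟨q, a, y, hq, hqp, haV, ha⟩

/-! ### The atom hypothesis -/

universe u

/-- **The atom hypothesis for the pair `(p, q)`** (relation form): every finite group containing elements `a, y` with
`AtomConfig p q a y` is not box-useful.  For distinct primes this says «the Schmidt atom `A(p,q)` — indeed every Frobenius
group `𝔽_p^m ⋊ C_q` — is not box-useful» (a section argument turns one into the other); it is the hypothesis under which
`BoxRatioSectionLawAtoms` proves C9 (b) for all finite solvable groups. [folklore] -/
def AtomBad (p q : ℕ) : Prop :=
  ∀ (H : Type u) [Group H] [Fintype H] [DecidableEq H] (a y : H), AtomConfig p q a y → ¬ BoxUseful H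

/-- The pair `(2, 3)` (the atom `A₄`) satisfies the atom hypothesis (`KleinRot`). [folklore] -/
theorem atomBad_two_three : AtomBad.{u} 2 3 := fun _ _ _ _ _ _ h => h.not_boxUseful_two_three

end Summit.MatrixMultiplication.OmegaCensus
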